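import Literature.MathematicalPhysics.QuantumLattice.GrassmannLaplacianScriptBound
import Literature.MathematicalPhysics.QuantumLattice.GrassmannKernelsPresented
import HarnessLib

/-!
# The kernels of `Δ_C W` and of the Gaussian convolution `e^{Δ_C} W`: exact formula and the Wick bound

Topic `MathematicalPhysics/QuantumLattice`; the LINEAR part of the renormalisation-group map `V ↦ effAction C V`
(`GrassmannEffectiveActionTruncation`: `effAction C V - e^{Δ_C}V` is second order) made explicit kernel by kernel.
Each Laplacian deletes one pair of fields: in degree `m` the kernel of `Δ_C W` is the degree-`m + 2` kernel of `W`
contracted with `C` on its last two legs, times the number `(m+1)(m+2)/2` of positions of the deleted pair: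

* `iterDeriv_snoc` (`∂_{(X,a)} = ∂_a ∘ ∂_X`), `iterDeriv_grassmannLaplacian` (derivatives commute with `Δ_C`),
  `constPart_iterDeriv_eq_mul_kernel`;
* **`kernel_grassmannLaplacian`** — `kernel (Δ_C W) m X = ((m+1)(m+2)/2) Σ_{A,B} C(A,B) kernel W (m+2) (X, B, A)`;
* **`sum_norm_kernel_grassmannLaplacian_le`** — one output leg pinned: `Σ_{X : X_i = w} ‖kernel (Δ_C W) m X‖ ≤
  ((m+1)(m+2)/2) · s · Σ_{Z : Z_i = w} ‖kernel W (m+2) Z‖` for `s ≥ ‖C(A,B)‖` (the Wick contraction costs the SUP norm of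
  the covariance, `≤ κ²` in Gram form);
* `sum_norm_kernel_grassmannLaplacian_pow_le` — `j` contractions: `((m+2j)!/(m! 2^j)) s^j`;
* **`sum_norm_kernel_gaussConv_sub_le`** — `Σ_{X : X_i = w} ‖kernel (e^{Δ_C}W - W) m X‖ ≤
  Σ_{1 ≤ j ≤ |Γ|/2} ((m+2j)!/(m! j! 2^j)) s^j N(m+2j)` given pinned norms `N` of the kernels of `W`: the first-order
  (tadpole / self-contraction) part of the flow of the degree-`m` kernels — for a quartic `W` the degree-`4` term
  vanishes (`λ' = λ` at first order) and the degree-`2` term is the tadpole `6 s N(4)`.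

Everything is proved; no definition, no named fact.

## Sources

G. Benfatto, A. Giuliani, V. Mastropietro, Ann. Henri Poincaré 7 (2006) 809–898, (2.12)–(2.14), (2.86)–(2.90)
[`BenfattoGiulianiMastropietro2006`]; M. Salmhofer, *Renormalization* (1999), §4.3 (4.86)–(4.95) [`Salmhofer1999`].
-/

noncomputable section

namespace Literature.MathematicalPhysics.QuantumLattice

open GrassmannAlgebra Finset
open scoped Nat

section Exact

variable (R : Type*) [CommRing R] [Algebra ℚ R] {Γ : Type*} [Fintype Γ]

omit [Algebra ℚ R] [Fintype Γ] in
/-- **Appending a label applies its derivative last**: `∂_{snoc X a} = ∂_a ∘ ∂_X`. [folklore] -/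
theorem iterDeriv_snoc {m : ℕ} (X : Fin m → Γ) (a : Γ) (W : GrassmannAlgebra R Γ) :
    iterDeriv R (Fin.snoc X a : Fin (m + 1) → Γ) W = grassmannDeriv R a (iterDeriv R X W) := by
  rw [iterDeriv, iterDeriv, List.ofFn_succ', List.concat_eq_append, List.reverse_append, List.reverse_singleton,
    List.singleton_append, List.prod_cons, Module.End.mul_apply]
  simp only [Fin.snoc_castSucc, Fin.snoc_last]

/-- **Iterated derivatives commute with the Laplacian.** [folklore] -/
theorem iterDeriv_grassmannLaplacian (C : Matrix Γ Γ R) {m : ℕ} (X : Fin m → Γ) (W : GrassmannAlgebra R Γ) :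
    iterDeriv R X (grassmannLaplacian R C W) = grassmannLaplacian R C (iterDeriv R X W) := by
  have h := commute_iterDeriv_of_forall R (fun Y => commute_grassmannDeriv_grassmannLaplacian R Y C) X
  exact congrFun (congrArg DFunLike.coe h.eq) W

omit [Fintype Γ] in
/-- `constPart (∂_X W) = m! · kernel W m X`. [folklore] -/
theorem constPart_iterDeriv_eq_mul_kernel {m : ℕ} (X : Fin m → Γ) (W : GrassmannAlgebra R Γ) :
    constPart R (iterDeriv R X W) = (m ! : R) * kernel R W m X := by
  have hne : (m ! : ℚ) ≠ 0 := by exact_mod_cast (Nat.factorial_pos m).ne'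
  have h1 : (m ! : R) = ((m ! : ℚ)) • (1 : R) := by rw [Nat.cast_smul_eq_nsmul, Nat.smul_one_eq_cast]
  rw [kernel_def, ← mul_assoc, h1, smul_mul_smul_comm, one_mul, mul_inv_cancel₀ hne, one_smul, one_mul]

/-- **The kernels of `Δ_C W`**: `kernel (Δ_C W) m X = ((m+1)(m+2)/2) Σ_{A,B} C(A,B) kernel W (m+2) (X, B, A)` — the
degree-`m+2` kernel contracted on its last two legs, times the number of positions of the deleted pair (Salmhofer 1999,
(4.86)). [cite: Salmhofer1999, §4.3.2 (4.86)] -/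
theorem kernel_grassmannLaplacian (C : Matrix Γ Γ R) (W : GrassmannAlgebra R Γ) (m : ℕ) (X : Fin m → Γ) :
    kernel R (grassmannLaplacian R C W) m X =
      (((((m + 1) * (m + 2) : ℕ) : ℚ) / 2) • (1 : R)) *
        ∑ A, ∑ B, C A B * kernel R W (m + 2) (Fin.snoc (Fin.snoc X B : Fin (m + 1) → Γ) A) := by
  rw [kernel_def, iterDeriv_grassmannLaplacian, grassmannLaplacian_apply, map_smul, map_sum]
  simp only [map_sum, map_smul, ← iterDeriv_snoc, constPart_iterDeriv_eq_mul_kernel, smul_eq_mul]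
  show ((m ! : ℚ)⁻¹ • (1 : R)) * (((1 / 2 : ℚ)) • (1 : R) * ∑ A, ∑ B, C A B *
      ((((m + 1 + 1)! : ℕ) : R) * kernel R W (m + 1 + 1) (Fin.snoc (Fin.snoc X B : Fin (m + 1) → Γ) A))) =
    (((((m + 1) * (m + 2) : ℕ) : ℚ) / 2) • (1 : R)) *
      ∑ A, ∑ B, C A B * kernel R W (m + 1 + 1) (Fin.snoc (Fin.snoc X B : Fin (m + 1) → Γ) A)
  simp only [Algebra.smul_def, mul_one, mul_sum]
  refine sum_congr rfl fun A _ => sum_congr rfl fun B _ => ?_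
  have hq : algebraMap ℚ R ((m ! : ℚ)⁻¹) * (algebraMap ℚ R (1 / 2) * (((m + 1 + 1)! : ℕ) : R)) =
      algebraMap ℚ R ((((m + 1) * (m + 2) : ℕ) : ℚ) / 2) := by
    rw [← map_natCast (algebraMap ℚ R), ← map_mul, ← map_mul]
    congr 1
    have hne : (m ! : ℚ) ≠ 0 := by exact_mod_cast (Nat.factorial_pos m).ne'
    rw [Nat.factorial_succ, Nat.factorial_succ]
    push_cast
    field_simp
    ring
  calc algebraMap ℚ R ((m ! : ℚ)⁻¹) * (algebraMap ℚ R (1 / 2) * (C A B *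
        ((((m + 1 + 1)! : ℕ) : R) * kernel R W (m + 1 + 1) (Fin.snoc (Fin.snoc X B : Fin (m + 1) → Γ) A))))
      = (algebraMap ℚ R ((m ! : ℚ)⁻¹) * (algebraMap ℚ R (1 / 2) * (((m + 1 + 1)! : ℕ) : R))) *
          (C A B * kernel R W (m + 1 + 1) (Fin.snoc (Fin.snoc X B : Fin (m + 1) → Γ) A)) := by ring
    _ = _ := by rw [hq]

end Exact

/-! ### The Wick bound -/

section Bound

variable {𝕜 : Type*} [RCLike 𝕜] {Γ : Type*} [Fintype Γ] [DecidableEq Γ]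

/-- **Re-indexing by the last two legs**: summing `g (X, B, A)` over `X` pinned at leg `i` and all `A, B` is summing `g`
over the `(m+2)`-strings pinned at leg `i`. [folklore] -/
theorem sum_filter_sum_sum_snoc_snoc_eq {M : Type*} [AddCommMonoid M] {m : ℕ} (g : (Fin (m + 1 + 1) → Γ) → M)
    (i : Fin m) (w : Γ) :
    ∑ X ∈ univ.filter (fun X : Fin m → Γ => X i = w), ∑ A, ∑ B, g (Fin.snoc (Fin.snoc X B : Fin (m + 1) → Γ) A) =
      ∑ Z ∈ univ.filter (fun Z : Fin (m + 1 + 1) → Γ => Z (Fin.castSucc (Fin.castSucc i)) = w), g Z := by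
  rw [sum_filter, sum_filter]
  symm
  calc ∑ Z : Fin (m + 1 + 1) → Γ, (if Z (Fin.castSucc (Fin.castSucc i)) = w then g Z else 0)
      = ∑ p : Γ × (Fin (m + 1) → Γ), (if (Fin.snoc p.2 p.1 : Fin (m + 1 + 1) → Γ) (Fin.castSucc (Fin.castSucc i)) = w
          then g (Fin.snoc p.2 p.1) else 0) :=
        (Fintype.sum_equiv (Fin.snocEquiv fun _ => Γ) _ _ fun p => rfl).symm
    _ = ∑ A, ∑ Y : Fin (m + 1) → Γ, (if (Fin.snoc Y A : Fin (m + 1 + 1) → Γ) (Fin.castSucc (Fin.castSucc i)) = w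
          then g (Fin.snoc Y A) else 0) := Fintype.sum_prod_type _
    _ = ∑ A, ∑ q : Γ × (Fin m → Γ), (if (Fin.snoc (Fin.snoc q.2 q.1 : Fin (m + 1) → Γ) A : Fin (m + 1 + 1) → Γ)
          (Fin.castSucc (Fin.castSucc i)) = w then g (Fin.snoc (Fin.snoc q.2 q.1 : Fin (m + 1) → Γ) A) else 0) :=
        sum_congr rfl fun A _ => (Fintype.sum_equiv (Fin.snocEquiv fun _ => Γ) _ _ fun q => rfl).symm
    _ = ∑ A, ∑ B, ∑ X : Fin m → Γ, (if X i = w then g (Fin.snoc (Fin.snoc X B : Fin (m + 1) → Γ) A) else 0) := by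
        refine sum_congr rfl fun A _ => ?_
        rw [Fintype.sum_prod_type]
        refine sum_congr rfl fun B _ => sum_congr rfl fun X _ => ?_
        simp only [Fin.snoc_castSucc]
    _ = ∑ A, ∑ X : Fin m → Γ, ∑ B, (if X i = w then g (Fin.snoc (Fin.snoc X B : Fin (m + 1) → Γ) A) else 0) :=
        sum_congr rfl fun A _ => sum_comm
    _ = ∑ X : Fin m → Γ, ∑ A, ∑ B, (if X i = w then g (Fin.snoc (Fin.snoc X B : Fin (m + 1) → Γ) A) else 0) := sum_comm
    _ = _ := sum_congr rfl fun X _ => by by_cases h : X i = w <;> simp [h]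

/-- **The Wick bound for one Laplacian, one output leg pinned**: if `‖C(A,B)‖ ≤ s` then
`Σ_{X : X_i = w} ‖kernel (Δ_C W) m X‖ ≤ ((m+1)(m+2)/2) · s · Σ_{Z : Z_i = w} ‖kernel W (m+2) Z‖` — a contraction costs the
sup norm of the covariance (`≤ κ²` in Gram form). [cite: BenfattoGiulianiMastropietro2006, (2.86)-(2.90)] -/
theorem sum_norm_kernel_grassmannLaplacian_le (C : Matrix Γ Γ 𝕜) {s : ℝ} (hs : ∀ A B, ‖C A B‖ ≤ s)
    (W : GrassmannAlgebra 𝕜 Γ) (m : ℕ) (i : Fin m) (w : Γ) :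
    ∑ X ∈ univ.filter (fun X : Fin m → Γ => X i = w), ‖kernel 𝕜 (grassmannLaplacian 𝕜 C W) m X‖ ≤
      (((m + 1) * (m + 2) : ℕ) : ℝ) / 2 * s *
        ∑ Z ∈ univ.filter (fun Z : Fin (m + 1 + 1) → Γ => Z (Fin.castSucc (Fin.castSucc i)) = w), ‖kernel 𝕜 W (m + 2) Z‖ := by
  have hs0 : 0 ≤ s := le_trans (norm_nonneg _) (hs w w)
  have hcoef : ‖(((((m + 1) * (m + 2) : ℕ) : ℚ) / 2) • (1 : 𝕜))‖ = (((m + 1) * (m + 2) : ℕ) : ℝ) / 2 := by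
    rw [Rat.smul_one_eq_cast, ← RCLike.ofReal_ratCast, RCLike.norm_ofReal]
    push_cast
    exact abs_of_nonneg (by positivity)
  -- pointwise
  have hpt : ∀ X : Fin m → Γ, ‖kernel 𝕜 (grassmannLaplacian 𝕜 C W) m X‖ ≤
      (((m + 1) * (m + 2) : ℕ) : ℝ) / 2 * s * ∑ A, ∑ B, ‖kernel 𝕜 W (m + 2) (Fin.snoc (Fin.snoc X B : Fin (m + 1) → Γ) A)‖ := by
    intro X
    rw [kernel_grassmannLaplacian, norm_mul, hcoef, mul_assoc]
    refine mul_le_mul_of_nonneg_left ?_ (by positivity)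
    rw [mul_sum]
    refine (norm_sum_le _ _).trans (sum_le_sum fun A _ => ?_)
    rw [mul_sum]
    refine (norm_sum_le _ _).trans (sum_le_sum fun B _ => ?_)
    rw [norm_mul]
    exact mul_le_mul_of_nonneg_right (hs A B) (norm_nonneg _)
  refine (sum_le_sum fun X _ => hpt X).trans (le_of_eq ?_)
  rw [← mul_sum, sum_filter_sum_sum_snoc_snoc_eq (fun Z => ‖kernel 𝕜 W (m + 2) Z‖) i w]

/-- **The Wick bound for `j` Laplacians**: with pinned norms `N(n)` of ALL the kernels of `W` (every leg),
`Σ_{X : X_i = w} ‖kernel (Δ_C^j W) m X‖ ≤ ((m+2j)!/(m! 2^j)) s^j N(m+2j)`. [cite: BenfattoGiulianiMastropietro2006, (2.86)-(2.90)] -/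
theorem sum_norm_kernel_grassmannLaplacian_pow_le (C : Matrix Γ Γ 𝕜) {s : ℝ} (hs : ∀ A B, ‖C A B‖ ≤ s)
    (W : GrassmannAlgebra 𝕜 Γ) (N : ℕ → ℝ)
    (hN : ∀ (n : ℕ) (p : Fin n) (w : Γ), ∑ Z ∈ univ.filter (fun Z : Fin n → Γ => Z p = w), ‖kernel 𝕜 W n Z‖ ≤ N n) :
    ∀ (j m : ℕ) (i : Fin m) (w : Γ),
      ∑ X ∈ univ.filter (fun X : Fin m → Γ => X i = w), ‖kernel 𝕜 ((grassmannLaplacian 𝕜 C ^ j) W) m X‖ ≤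
        ((m + 2 * j)! : ℝ) / ((m ! : ℝ) * 2 ^ j) * s ^ j * N (m + 2 * j)
  | 0, m, i, w => by
    have h := hN m i w
    simp only [pow_zero, Module.End.one_apply, Nat.mul_zero, Nat.add_zero, mul_one]
    rwa [div_self (by positivity), one_mul]
  | j + 1, m, i, w => by
    have hs0 : 0 ≤ s := le_trans (norm_nonneg _) (hs w w)
    rw [pow_succ', Module.End.mul_apply]
    refine (sum_norm_kernel_grassmannLaplacian_le C hs _ m i w).trans ?_
    have ih := sum_norm_kernel_grassmannLaplacian_pow_le C hs W N hN j (m + 1 + 1) (Fin.castSucc (Fin.castSucc i)) w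
    refine (mul_le_mul_of_nonneg_left ih (by positivity)).trans (le_of_eq ?_)
    have hmf : ((m + 1 + 1)! : ℝ) = (m + 1 + 1 : ℝ) * ((m + 1 : ℝ) * (m ! : ℝ)) := by
      rw [Nat.factorial_succ, Nat.factorial_succ]; push_cast; ring
    rw [show m + 1 + 1 + 2 * j = m + 2 * (j + 1) by ring, hmf]
    have hm0 : (m ! : ℝ) ≠ 0 := by positivity
    push_cast
    field_simp
    ring

/-- **The first-order part of the flow, kernel by kernel**: if `Δ_C^k = 0` (any nilpotency bound) and `‖C(A,B)‖ ≤ s`, then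
for every degree `m` and pinned output leg,
`Σ_{X : X_i = w} ‖kernel (e^{Δ_C}W - W) m X‖ ≤ Σ_{1 ≤ j < k} ((m+2j)!/(m! j! 2^j)) s^j N(m+2j)` — the self-contractions of
the higher kernels of `W` feeding degree `m` (for a quartic `W`: nothing in degree `4`, the tadpole `6 s N(4)` in degree `2`).
[cite: BenfattoGiulianiMastropietro2006, (2.86)-(2.90)] -/
theorem sum_norm_kernel_gaussConv_sub_le (C : Matrix Γ Γ 𝕜) {k : ℕ} (hk : grassmannLaplacian 𝕜 C ^ k = 0) {s : ℝ}
    (hs : ∀ A B, ‖C A B‖ ≤ s) (W : GrassmannAlgebra 𝕜 Γ) (N : ℕ → ℝ)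
    (hN : ∀ (n : ℕ) (p : Fin n) (w : Γ), ∑ Z ∈ univ.filter (fun Z : Fin n → Γ => Z p = w), ‖kernel 𝕜 W n Z‖ ≤ N n)
    (m : ℕ) (i : Fin m) (w : Γ) :
    ∑ X ∈ univ.filter (fun X : Fin m → Γ => X i = w), ‖kernel 𝕜 (gaussConv 𝕜 C W - W) m X‖ ≤
      ∑ j ∈ Ico 1 k, ((m + 2 * j)! : ℝ) / ((m ! : ℝ) * (j ! : ℝ) * 2 ^ j) * s ^ j * N (m + 2 * j) := by
  have hs0 : 0 ≤ s := le_trans (norm_nonneg _) (hs w w)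
  -- `e^{Δ}W - W = Σ_{1 ≤ j < k} (j!)⁻¹ Δ^j W`
  have hexp : gaussConv 𝕜 C W - W = ∑ j ∈ Ico 1 k, ((j ! : ℚ)⁻¹) • (grassmannLaplacian 𝕜 C ^ j) W := by
    rcases Nat.eq_zero_or_pos k with rfl | hkpos
    · -- `Δ^0 = 1 = 0`: the algebra of endomorphisms is trivial, so is `W`
      have h1 : (1 : Module.End 𝕜 (GrassmannAlgebra 𝕜 Γ)) = 0 := by rwa [pow_zero] at hk
      have hW : W = 0 := by simpa using congrArg (fun T : Module.End 𝕜 (GrassmannAlgebra 𝕜 Γ) => T W) h1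
      simp [hW]
    · rw [gaussConv, IsNilpotent.exp_eq_sum hk, LinearMap.coe_sum, Finset.sum_apply, range_eq_Ico,
        sum_eq_sum_Ico_succ_bot hkpos]
      simp only [LinearMap.smul_apply, pow_zero, Nat.factorial_zero, Nat.cast_one, inv_one, one_smul,
        Module.End.one_apply, add_sub_cancel_left]
  rw [hexp]
  calc ∑ X ∈ univ.filter (fun X : Fin m → Γ => X i = w),
        ‖kernel 𝕜 (∑ j ∈ Ico 1 k, ((j ! : ℚ)⁻¹) • (grassmannLaplacian 𝕜 C ^ j) W) m X‖
      ≤ ∑ X ∈ univ.filter (fun X : Fin m → Γ => X i = w),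
          ∑ j ∈ Ico 1 k, (j ! : ℝ)⁻¹ * ‖kernel 𝕜 ((grassmannLaplacian 𝕜 C ^ j) W) m X‖ := by
        refine sum_le_sum fun X _ => ?_
        rw [kernel_sum]
        refine (norm_sum_le _ _).trans (sum_le_sum fun j _ => le_of_eq ?_)
        rw [← Rat.cast_smul_eq_qsmul 𝕜, kernel_smul, norm_mul, Rat.cast_inv, Rat.cast_natCast, norm_inv,
          RCLike.norm_natCast]
    _ = ∑ j ∈ Ico 1 k, (j ! : ℝ)⁻¹ * ∑ X ∈ univ.filter (fun X : Fin m → Γ => X i = w),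
          ‖kernel 𝕜 ((grassmannLaplacian 𝕜 C ^ j) W) m X‖ := by
        rw [sum_comm]
        exact sum_congr rfl fun j _ => by rw [mul_sum]
    _ ≤ ∑ j ∈ Ico 1 k, (j ! : ℝ)⁻¹ * (((m + 2 * j)! : ℝ) / ((m ! : ℝ) * 2 ^ j) * s ^ j * N (m + 2 * j)) :=
        sum_le_sum fun j _ => mul_le_mul_of_nonneg_left
          (sum_norm_kernel_grassmannLaplacian_pow_le C hs W N hN j m i w) (by positivity)
    _ = _ := sum_congr rfl fun j _ => by
        have hj : (j ! : ℝ) ≠ 0 := by positivity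
        have hm : (m ! : ℝ) ≠ 0 := by positivity
        field_simp

end Bound

end Literature.MathematicalPhysics.QuantumLattice
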